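import Summits.MatrixMultiplication.MatrixMultiplication.Theorems.SaturationLadderLevelTwoKit
import Literature.Computability.AlgebraicComplexity.BigCwSquareFormatValueMatrix
import HarnessLib

/-!
# Level 2 of the saturation ladder at `ω(1,3,1)` — the design (`d = 2448`, `q = 6`)
# (route `SaturationLadder`, node `TailDescentTwo`, lens 1, gen 22)

Cell `decomp-mm`, lens 1, gen 22, file 4 of 5 (the rung itself is `SaturationLadderLevelTwoK3`:
`ω(1,3,1) ≤ 80/19`).  No named facts, no sorry; the definitions are the explicit design.

THE WORD.  The outer laser method (`laserMethod_hasFormatValue_of_wordValue`) runs on ONE valued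
word: `lvl2Word` of length `2448 = 1344 + 8 · 138` over the level-2 support at `q = 6` lists eleven
matrix letters as constant runs (counts `040:4, 004:4, 310:2, 130:27, 220:99, 301:2, 103:27,
202:99, 031:144, 013:144, 022:792`; NO letter `400`) followed by `138` repetitions of the 8-letter
family word `cwSqFam332Word` (`BigCwSquarePieces`: the `3 : 3 : 2` block of `[112]_σ, [121]_σ,
[211]''` at `σ = 19/20`); its block format value is `(V; X, Y, X)` with `V = (2^6)^{138}`,
`X = 12^{29} 38^{99} (6^5)^{138}`, `Y = 12^{288} 38^{792} (6^{57/10})^{138}` (`2q = 12`,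
`q² + 2 = 38`; `hasFormatValue_lvl2Word`).

THE LAW.  The law `lvl2Law` of the word is of product form `f(I) g(J) g(L)` on the fourteen used
letters (`f = (67712/11, 12696/11, 276, 2)/2448`, `g = (1, 1, 33/92, 99/4232, 11/16928)`;
integrality forced `2·n₁₃₀·n₀₂₂ = 3·n₂₂₀·n₀₃₁`), its row `I = 4` has marginal zero, so its
penalty over `cwSupport₂` is `0` (`maxEntropyPenalty_lvl2Law`, by the kit's zero-row lemma and
`maxEntropyPenalty_eq_zero_of_mul`); marginals `x : (1088, 882, 474, 4, 0)/2448`,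
`y = z : (132, 836, 1305, 171, 4)/2448`.

## References

* F. Le Gall, *Faster algorithms for rectangular matrix multiplication*, FOCS 2012,
  arXiv:1204.1111, §3, §6.1, Prop. 6.2, Table 2. [LeGall2012]
* D. Coppersmith, S. Winograd, *Matrix multiplication via arithmetic progressions*,
  J. Symbolic Comput. 9 (1990), §8. [CoppersmithWinograd1990]
* D. Coppersmith, *Rectangular matrix multiplication revisited*, J. Complexity 13 (1997), §3.
  [Coppersmith1997]
* F. Le Gall, *Powers of tensors and fast matrix multiplication*, ISSAC 2014, arXiv:1401.7714,
  Thm. 4.1 and Appendix A.3. [LeGall2014]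
* V. Vassilevska Williams, Y. Xu, Z. Xu, R. Zhou, *New bounds for matrix multiplication: from
  alpha to omega*, SODA 2024, Table 1. [VassilevskaWilliamsXuXuZhou2024]
-/

set_option linter.dupNamespace false
set_option autoImplicit false
set_option exponentiation.threshold 100000
set_option maxRecDepth 100000

noncomputable section

open Finset Real
open scoped BigOperators

namespace Summit.MatrixMultiplication.MatrixMultiplication.Theorems.SaturationLadderLevelTwoK3

open Literature.Computability.AlgebraicComplexity
open SaturationLadderLevelTwoKit
open SaturationLadderLevelTwo (append_mem repWord_mem const_mem fin5_lits negMulLog_div'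
  log_two_mul_shannonEntropy_fin5)

/-! ## The design -/

/-- **The matrix part of the design**: eleven matrix letters of `CW_6^{⊗2}` as constant runs with
counts `040:4, 004:4, 310:2, 130:27, 220:99, 301:2, 103:27, 202:99, 031:144, 013:144, 022:792`
(total `1344`). [folklore] -/
def matWord : Fin 1344 → PL5 :=
  Fin.append (fun _ : Fin 4 => ((0 : Fin 5), (4 : Fin 5), (0 : Fin 5))) <|
  Fin.append (fun _ : Fin 4 => ((0 : Fin 5), (0 : Fin 5), (4 : Fin 5))) <|
  Fin.append (fun _ : Fin 2 => ((3 : Fin 5), (1 : Fin 5), (0 : Fin 5))) <|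
  Fin.append (fun _ : Fin 27 => ((1 : Fin 5), (3 : Fin 5), (0 : Fin 5))) <|
  Fin.append (fun _ : Fin 99 => ((2 : Fin 5), (2 : Fin 5), (0 : Fin 5))) <|
  Fin.append (fun _ : Fin 2 => ((3 : Fin 5), (0 : Fin 5), (1 : Fin 5))) <|
  Fin.append (fun _ : Fin 27 => ((1 : Fin 5), (0 : Fin 5), (3 : Fin 5))) <|
  Fin.append (fun _ : Fin 99 => ((2 : Fin 5), (0 : Fin 5), (2 : Fin 5))) <|
  Fin.append (fun _ : Fin 144 => ((0 : Fin 5), (3 : Fin 5), (1 : Fin 5))) <|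
  Fin.append (fun _ : Fin 144 => ((0 : Fin 5), (1 : Fin 5), (3 : Fin 5)))
    (fun _ : Fin 792 => ((0 : Fin 5), (2 : Fin 5), (2 : Fin 5)))

/-- **The level-2 word for `ω(1,3,1)`** (`d = 2448`): the matrix part followed by `138`
repetitions of the `3 : 3 : 2` family word. [folklore] -/
def lvl2Word : Fin 2448 → PL5 := Fin.append matWord (repWord cwSqFam332Word 138)

/-- The letters of the matrix part lie in the used support. [folklore] -/
theorem matWord_mem : ∀ ρ, matWord ρ ∈ supp14 := by
  have h := append_mem
    (const_mem (S := supp14) (a := ((0 : Fin 5), (4 : Fin 5), (0 : Fin 5))) (by decide) 4)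
    (append_mem
    (const_mem (S := supp14) (a := ((0 : Fin 5), (0 : Fin 5), (4 : Fin 5))) (by decide) 4)
    (append_mem
    (const_mem (S := supp14) (a := ((3 : Fin 5), (1 : Fin 5), (0 : Fin 5))) (by decide) 2)
    (append_mem
    (const_mem (S := supp14) (a := ((1 : Fin 5), (3 : Fin 5), (0 : Fin 5))) (by decide) 27)
    (append_mem
    (const_mem (S := supp14) (a := ((2 : Fin 5), (2 : Fin 5), (0 : Fin 5))) (by decide) 99)
    (append_mem
    (const_mem (S := supp14) (a := ((3 : Fin 5), (0 : Fin 5), (1 : Fin 5))) (by decide) 2)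
    (append_mem
    (const_mem (S := supp14) (a := ((1 : Fin 5), (0 : Fin 5), (3 : Fin 5))) (by decide) 27)
    (append_mem
    (const_mem (S := supp14) (a := ((2 : Fin 5), (0 : Fin 5), (2 : Fin 5))) (by decide) 99)
    (append_mem
    (const_mem (S := supp14) (a := ((0 : Fin 5), (3 : Fin 5), (1 : Fin 5))) (by decide) 144)
    (append_mem
    (const_mem (S := supp14) (a := ((0 : Fin 5), (1 : Fin 5), (3 : Fin 5))) (by decide) 144)
    ((const_mem (S := supp14) (a := ((0 : Fin 5), (2 : Fin 5), (2 : Fin 5))) (by decide)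
      792)))))))))))
  exact h

/-- The letters of the family repetitions lie in the used support. [folklore] -/
theorem famRep_mem : ∀ ρ, repWord cwSqFam332Word 138 ρ ∈ supp14 := by
  refine repWord_mem (fun ρ => ?_) 138
  have h := cwSqFam332Word_mem ρ
  simp only [Finset.mem_insert, Finset.mem_singleton] at h
  rcases h with h | h | h <;> rw [h] <;> decide

/-- The letters of the level-2 word lie in the used support. [folklore] -/
theorem lvl2Word_mem_supp14 : ∀ ρ, lvl2Word ρ ∈ supp14 := by
  unfold lvl2Word
  exact append_mem matWord_mem famRep_mem

/-- The letters of the level-2 word lie in the level-2 support. [folklore] -/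
theorem lvl2Word_mem : ∀ ρ, lvl2Word ρ ∈ cwSupport₂ := fun ρ => supp14_subset (lvl2Word_mem_supp14 ρ)

/-- **The letter counts of the level-2 word.** [folklore] -/
theorem letterCount_lvl2Word (s : PL5) : letterCount lvl2Word s =
    (if s = (0, 4, 0) then 4 else 0) + ((if s = (0, 0, 4) then 4 else 0) +
    ((if s = (3, 1, 0) then 2 else 0) + ((if s = (1, 3, 0) then 27 else 0) +
    ((if s = (2, 2, 0) then 99 else 0) + ((if s = (3, 0, 1) then 2 else 0) +
    ((if s = (1, 0, 3) then 27 else 0) + ((if s = (2, 0, 2) then 99 else 0) +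
    ((if s = (0, 3, 1) then 144 else 0) + ((if s = (0, 1, 3) then 144 else 0) +
    (if s = (0, 2, 2) then 792 else 0)))))))))) +
    138 * ((if s = (1, 1, 2) then 3 else 0) + (if s = (1, 2, 1) then 3 else 0) +
      (if s = (2, 1, 1) then 2 else 0)) := by
  simp only [lvl2Word, matWord, letterCount_append, Pi.add_apply, letterCount_const,
    letterCount_repWord, letterCount_cwSqFam332Word]

/-! ## The block value of the word -/

/-- **The matrix part is worth `(1; 12^29·38^99, 12^288·38^792, 12^29·38^99)`** (products of
the eleven matrix format values `(1; cwSqFmtA, cwSqFmtB, cwSqFmtC)` at `q = 6`: `2q = 12`,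
`q²+2 = 38`). [cite: LeGall2012, §3 and §6.1] [cite: CoppersmithWinograd1990, §8] -/
theorem hasFormatValue_matWord : HasFormatValue (blockOf matWord) 1 ((12 : ℝ) ^ 29 * 38 ^ 99)
    ((12 : ℝ) ^ 288 * 38 ^ 792) ((12 : ℝ) ^ 29 * 38 ^ 99) := by
  have h040 : HasFormatValue (cwSqComp ℂ 6 0 4 0) 1 1 1 1 := hasFormatValue_cwSqComp040 ℂ 6
  have h004 : HasFormatValue (cwSqComp ℂ 6 0 0 4) 1 1 1 1 := hasFormatValue_cwSqComp004 ℂ 6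
  have h310 : HasFormatValue (cwSqComp ℂ 6 3 1 0) 1 12 1 1 := by
    have h := hasFormatValue_cwSqComp310 ℂ 6; norm_num at h; exact h
  have h130 : HasFormatValue (cwSqComp ℂ 6 1 3 0) 1 12 1 1 := by
    have h := hasFormatValue_cwSqComp130 ℂ 6; norm_num at h; exact h
  have h220 : HasFormatValue (cwSqComp ℂ 6 2 2 0) 1 38 1 1 := by
    have h := hasFormatValue_cwSqComp220 ℂ 6; norm_num at h; exact h
  have h301 : HasFormatValue (cwSqComp ℂ 6 3 0 1) 1 1 1 12 := by
    have h := hasFormatValue_cwSqComp301 ℂ 6; norm_num at h; exact h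
  have h103 : HasFormatValue (cwSqComp ℂ 6 1 0 3) 1 1 1 12 := by
    have h := hasFormatValue_cwSqComp103 ℂ 6; norm_num at h; exact h
  have h202 : HasFormatValue (cwSqComp ℂ 6 2 0 2) 1 1 1 38 := by
    have h := hasFormatValue_cwSqComp202 ℂ 6; norm_num at h; exact h
  have h031 : HasFormatValue (cwSqComp ℂ 6 0 3 1) 1 1 12 1 := by
    have h := hasFormatValue_cwSqComp031 ℂ 6; norm_num at h; exact h
  have h013 : HasFormatValue (cwSqComp ℂ 6 0 1 3) 1 1 12 1 := by
    have h := hasFormatValue_cwSqComp013 ℂ 6; norm_num at h; exact h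
  have h022 : HasFormatValue (cwSqComp ℂ 6 0 2 2) 1 1 38 1 := by
    have h := hasFormatValue_cwSqComp022 ℂ 6; norm_num at h; exact h
  have h := app (blk (0, 4, 0) 4 h040) <| app (blk (0, 0, 4) 4 h004) <|
    app (blk (3, 1, 0) 2 h310) <| app (blk (1, 3, 0) 27 h130) <| app (blk (2, 2, 0) 99 h220) <|
    app (blk (3, 0, 1) 2 h301) <| app (blk (1, 0, 3) 27 h103) <| app (blk (2, 0, 2) 99 h202) <|
    app (blk (0, 3, 1) 144 h031) <| app (blk (0, 1, 3) 144 h013) (blk (0, 2, 2) 792 h022)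
  unfold matWord
  convert h using 1 <;> (simp only [one_pow, one_mul, mul_one]; ring)

/-- **The family repetitions are worth `((2^6)^{138}; (6^5)^{138}, (6^{57/10})^{138},
(6^5)^{138})`** (the `3 : 3 : 2` block at `σ = 19/20`, repeated). [cite: LeGall2012, Prop. 6.2] -/
theorem hasFormatValue_famRep :
    HasFormatValue (blockOf (repWord cwSqFam332Word 138)) (((2 : ℝ) ^ (6 : ℝ)) ^ 138)
      (((6 : ℝ) ^ (5 : ℝ)) ^ 138) (((6 : ℝ) ^ ((57 : ℝ) / 10)) ^ 138)
      (((6 : ℝ) ^ (5 : ℝ)) ^ 138) := by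
  have h := hasFormatValue_laserBlock_cwSqFam332Word ℂ 6 (by norm_num)
  have h6 : (0 : ℝ) ≤ (6 : ℕ) := by norm_num
  have h' := h.laserBlock_repWord cwLev2 cwLev2 cwLev2 (bigCwSq ℂ 6) (by positivity)
    (Real.rpow_nonneg h6 _) (Real.rpow_nonneg h6 _) (Real.rpow_nonneg h6 _) 138
  simpa using h'

/-- The total `x`- (and `z`-) format of the word. [folklore] -/
def Xtot : ℝ := (12 : ℝ) ^ 29 * 38 ^ 99 * (((6 : ℝ) ^ (5 : ℝ)) ^ 138)

/-- The total `y`-format of the word. [folklore] -/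
def Ytot : ℝ := (12 : ℝ) ^ 288 * 38 ^ 792 * (((6 : ℝ) ^ ((57 : ℝ) / 10)) ^ 138)

/-- The total value of the word. [folklore] -/
def Vtot : ℝ := 1 * ((2 : ℝ) ^ (6 : ℝ)) ^ 138

/-- `X > 0`. [folklore] -/
theorem Xtot_pos : 0 < Xtot := by unfold Xtot; positivity

/-- `Y > 0`. [folklore] -/
theorem Ytot_pos : 0 < Ytot := by unfold Ytot; positivity

/-- `V > 0`. [folklore] -/
theorem Vtot_pos : 0 < Vtot := by unfold Vtot; positivity

/-- **The block value of the level-2 word**: `(V; X, Y, X)`.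
[cite: LeGall2012, §6.1 and Prop. 6.2] -/
theorem hasFormatValue_lvl2Word : HasFormatValue (blockOf lvl2Word) Vtot Xtot Ytot Xtot := by
  unfold lvl2Word Vtot Xtot Ytot
  have h6 : (0 : ℝ) ≤ 6 := by norm_num
  exact hasFormatValue_matWord.laserBlock_append cwLev2 cwLev2 cwLev2 (bigCwSq ℂ 6)
    hasFormatValue_famRep zero_le_one (by positivity) (by positivity)
    (pow_nonneg (Real.rpow_nonneg h6 _) _) (by positivity) (pow_nonneg (Real.rpow_nonneg h6 _) _)
    (by positivity) (pow_nonneg (Real.rpow_nonneg h6 _) _)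

/-! ## The law of the word: product form on the used support -/

/-- **The law of the word** (its type divided by its length). [folklore] -/
def lvl2Law (s : PL5) : ℝ := (letterCount lvl2Word s : ℝ) / 2448

/-- The law, with the length as a cast natural. [folklore] -/
theorem lvl2Law_eq (s : PL5) :
    lvl2Law s = (letterCount lvl2Word s : ℝ) / ((2448 : ℕ) : ℝ) := by
  rw [lvl2Law]; simp only [Nat.cast_ofNat]

/-- The law vanishes off the used support. [folklore] -/
theorem lvl2Law_eq_zero' (s : PL5) (hs : s ∉ supp14) : lvl2Law s = 0 := by
  rw [lvl2Law, letterCount_eq_zero_of_forall_mem lvl2Word_mem_supp14 s hs]; simp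

/-- The law vanishes off the level-2 support. [folklore] -/
theorem lvl2Law_eq_zero (s : PL5) (hs : s ∉ cwSupport₂) : lvl2Law s = 0 :=
  lvl2Law_eq_zero' s fun h => hs (supp14_subset h)

/-- The law is nonnegative. [folklore] -/
theorem lvl2Law_nonneg (s : PL5) : 0 ≤ lvl2Law s := by unfold lvl2Law; positivity

/-- The law sums to one. [folklore] -/
theorem sum_lvl2Law : ∑ s, lvl2Law s = 1 := by
  show ∑ s, (letterCount lvl2Word s : ℝ) / 2448 = 1
  rw [← Finset.sum_div, ← Nat.cast_sum, sum_letterCount lvl2Word]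
  norm_num

/-- The law is a probability vector. [folklore] -/
theorem lvl2Law_mem_stdSimplex : lvl2Law ∈ stdSimplex ℝ PL5 := ⟨lvl2Law_nonneg, sum_lvl2Law⟩

/-- The `x`-factor of the product form of the counts (divided by the length; the value at the
unused row `I = 4` is immaterial). [folklore] -/
def fX (i : Fin 5) : ℝ :=
  (if i = 0 then 67712 / 11 else if i = 1 then 12696 / 11 else if i = 2 then 276 else 2) / 2448

/-- The `y`- and `z`-factor of the product form of the counts. [folklore] -/
def gY (j : Fin 5) : ℝ :=
  if j = 0 then 1 else if j = 1 then 1 else if j = 2 then 33 / 92 else if j = 3 then 99 / 4232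
    else 11 / 16928

/-- The `x`-factor is positive. [folklore] -/
theorem fX_pos (i : Fin 5) : 0 < fX i := by unfold fX; split_ifs <;> norm_num

/-- The `y`-factor is positive. [folklore] -/
theorem gY_pos (j : Fin 5) : 0 < gY j := by unfold gY; split_ifs <;> norm_num

/-- **The law is of product form on the used support**: `n_{IJL} = f(I) g(J) g(L)`. [folklore] -/
theorem lvl2Law_prod : ∀ x ∈ supp14, lvl2Law x = fX x.1 * gY x.2.1 * gY x.2.2 := by
  intro x hx
  simp only [supp14, Finset.mem_insert, Finset.mem_singleton] at hx
  rcases hx with rfl | rfl | rfl | rfl | rfl | rfl | rfl | rfl | rfl | rfl | rfl | rfl | rfl | rfl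
  all_goals norm_num [lvl2Law, letterCount_lvl2Word, fX, gY, fin5_lits]

/-! ## Marginals and penalty zero -/

/-- The `x`-marginal: `(1088, 882, 474, 4, 0)/2448`. [folklore] -/
theorem marginalDist₁_lvl2Law :
    marginalDist₁ lvl2Law 0 = 1088 / 2448 ∧ marginalDist₁ lvl2Law 1 = 882 / 2448 ∧
      marginalDist₁ lvl2Law 2 = 474 / 2448 ∧ marginalDist₁ lvl2Law 3 = 4 / 2448 ∧
      marginalDist₁ lvl2Law 4 = 0 := by
  simp only [marginalDist₁_eq_sum_filter supp14 lvl2Law_eq_zero', supp14]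
  refine ⟨?_, ?_, ?_, ?_, ?_⟩ <;>
    norm_num [Finset.filter_insert, Finset.filter_singleton, lvl2Law, letterCount_lvl2Word,
      fin5_lits]

/-- The `y`-marginal: `(132, 836, 1305, 171, 4)/2448`. [folklore] -/
theorem marginalDist₂_lvl2Law :
    marginalDist₂ lvl2Law 0 = 132 / 2448 ∧ marginalDist₂ lvl2Law 1 = 836 / 2448 ∧
      marginalDist₂ lvl2Law 2 = 1305 / 2448 ∧ marginalDist₂ lvl2Law 3 = 171 / 2448 ∧
      marginalDist₂ lvl2Law 4 = 4 / 2448 := by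
  simp only [marginalDist₂_eq_sum_filter supp14 lvl2Law_eq_zero', supp14]
  refine ⟨?_, ?_, ?_, ?_, ?_⟩ <;>
    norm_num [Finset.filter_insert, Finset.filter_singleton, lvl2Law, letterCount_lvl2Word,
      fin5_lits]

/-- The `z`-marginal: `(132, 836, 1305, 171, 4)/2448`. [folklore] -/
theorem marginalDist₃_lvl2Law :
    marginalDist₃ lvl2Law 0 = 132 / 2448 ∧ marginalDist₃ lvl2Law 1 = 836 / 2448 ∧
      marginalDist₃ lvl2Law 2 = 1305 / 2448 ∧ marginalDist₃ lvl2Law 3 = 171 / 2448 ∧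
      marginalDist₃ lvl2Law 4 = 4 / 2448 := by
  simp only [marginalDist₃_eq_sum_filter supp14 lvl2Law_eq_zero', supp14]
  refine ⟨?_, ?_, ?_, ?_, ?_⟩ <;>
    norm_num [Finset.filter_insert, Finset.filter_singleton, lvl2Law, letterCount_lvl2Word,
      fin5_lits]

/-- **Penalty zero**: `Γ_{cwSupport₂}(P) = Γ_{supp14}(P) = 0` for the law of the word (row `I = 4`
has marginal zero; product form on the used support).
[cite: LeGall2012, §6.1] [cite: CoppersmithWinograd1990, §8] -/
theorem maxEntropyPenalty_lvl2Law : maxEntropyPenalty cwSupport₂ lvl2Law = 0 := by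
  rw [maxEntropyPenalty_eq_of_row_zero supp14_subset (fun x hx hx' => by
    rw [eq_400_of_not_mem_supp14 x hx hx']; exact marginalDist₁_lvl2Law.2.2.2.2)]
  exact maxEntropyPenalty_eq_zero_of_mul supp14 lvl2Law_mem_stdSimplex lvl2Law_eq_zero' fX gY gY
    (fun x _ => fX_pos x.1) (fun x _ => gY_pos x.2.1) (fun x _ => gY_pos x.2.2) lvl2Law_prod

end Summit.MatrixMultiplication.MatrixMultiplication.Theorems.SaturationLadderLevelTwoK3

end
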